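import Summits.AtomisticToContinuum.Crystallization.Theorems.PalmUnimodularRigidityShellsToBarlowChartDefs

/-!
# Quadratic growth of quotient balls (stub `stub_quotientGrowth`)

Line `develop-the-model-growth-descent` of the crux `ShellsToBarlowChart`
(`stmt-AtomisticToContinuum-9227`). If `Ψ` is star-surjective from the model
`B = barlowStacking 1 √(2/3) s` and invariant under a non-zero two-sided period `τ` of `B`, the
window-graph balls of `S` about `Ψ p` grow at most quadratically: walks lift to contact chains
(`lift_walk`), `τ = barlowPos 1 √(2/3) s m a b` is a lattice vector, and reducing the lifted
endpoint modulo `τ` confines one integer index to a constant window, the two others to windows of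
length `O(n)` (`reduced_index_bounds`); an integer box count finishes (`ncard_le_quadratic`).
-/

noncomputable section

namespace Summit.AtomisticToContinuum.Crystallization.Theorems.PalmUnimodularRigidityShellsToBarlowChart

open Literature.Geometry.DiscreteGeometry Literature.MathematicalPhysics.StatisticalMechanics
open Summit.AtomisticToContinuum.Crystallization.Theorems.ShellsToBarlowChartNegative

/-- Euclidean `3`-space. -/
local notation "E3" => EuclideanSpace ℝ (Fin 3)


namespace QuotientGrowth

/-! ## Path lifting -/

/-- An adjacency of the window graph at `x` ends at a bonded neighbour of `x`. [folklore] -/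
theorem mem_bondNbrs_of_windowGraph_adj {S : Set E3} {x z : E3} (h : (windowGraph S).Adj x z) :
    z ∈ bondNbrs S x := by
  unfold windowGraph at h
  rw [SimpleGraph.fromRel_adj] at h
  rcases h with ⟨-, ⟨-, hz, hb⟩ | ⟨hz, -, hb⟩⟩
  · exact ⟨hz, hb⟩
  · exact ⟨hz, by unfold IsBond at hb ⊢; rwa [dist_comm]⟩

/-- **Path lifting.** If every bonded neighbour of `Ψ p` is the image of a contact of `p` (for
every site `p` of the model), then every walk of the window graph starting at `Ψ p` ends at the
image of a site at distance at most the length of the walk from `p`. [folklore] -/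
theorem lift_walk {S : Set E3} {s : ℤ → ℤ} {Ψ : E3 → E3}
    (hstar : ∀ p ∈ barlowStacking 1 (Real.sqrt (2 / 3)) s, bondNbrs S (Ψ p) ⊆ Ψ '' contacts s p)
    {x y : E3} (w : (windowGraph S).Walk x y) :
    ∀ p ∈ barlowStacking 1 (Real.sqrt (2 / 3)) s, Ψ p = x →
      ∃ q ∈ barlowStacking 1 (Real.sqrt (2 / 3)) s, Ψ q = y ∧ dist p q ≤ w.length := by
  induction w with
  | nil => exact fun p hp hpx => ⟨p, hp, hpx, by simp⟩
  | cons hadj w ih =>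
    intro p hp hpx
    subst hpx
    obtain ⟨q₁, ⟨hq₁B, hq₁d⟩, hq₁⟩ := hstar p hp (mem_bondNbrs_of_windowGraph_adj hadj)
    obtain ⟨q, hqB, hqy, hqd⟩ := ih q₁ hq₁B hq₁
    refine ⟨q, hqB, hqy, ?_⟩
    rw [SimpleGraph.Walk.length_cons, Nat.cast_add, Nat.cast_one]
    calc dist p q ≤ dist p q₁ + dist q₁ q := dist_triangle _ _ _
      _ ≤ 1 + w.length := by rw [hq₁d]; linarith
      _ = w.length + 1 := by ring

/-- Graph balls about the image of a site are images of metric balls of the model about the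
site (in index form). [folklore] -/
theorem exists_lift_of_mem_windowBall {S : Set E3} {s : ℤ → ℤ} {Ψ : E3 → E3}
    (hstar : ∀ p ∈ barlowStacking 1 (Real.sqrt (2 / 3)) s, bondNbrs S (Ψ p) ⊆ Ψ '' contacts s p)
    {k₀ i₀ j₀ : ℤ} {n : ℕ} {y : E3}
    (hy : y ∈ windowBall S (Ψ (barlowPos 1 (Real.sqrt (2 / 3)) s k₀ i₀ j₀)) n) :
    ∃ k i j : ℤ, Ψ (barlowPos 1 (Real.sqrt (2 / 3)) s k i j) = y ∧
      dist (barlowPos 1 (Real.sqrt (2 / 3)) s k i j) (barlowPos 1 (Real.sqrt (2 / 3)) s k₀ i₀ j₀)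
        ≤ n := by
  obtain ⟨w, hw⟩ := hy
  obtain ⟨q, ⟨k, i, j, rfl⟩, hqy, hqd⟩ := lift_walk hstar w _ (barlowPos_mem k₀ i₀ j₀) rfl
  exact ⟨k, i, j, hqy, by rw [dist_comm]; exact hqd.trans (by exact_mod_cast hw)⟩

/-! ## Lattice facts of the model -/

/-- Iterating a two-sided period `τ` under which `Ψ` is invariant: `q + z • τ` is a site and has
the same image, for every integer `z`. [folklore] -/
theorem period_iterate {s : ℤ → ℤ} {Ψ : E3 → E3} {τ : E3}
    (hper : ∀ q ∈ barlowStacking 1 (Real.sqrt (2 / 3)) s,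
      q + τ ∈ barlowStacking 1 (Real.sqrt (2 / 3)) s ∧ q - τ ∈ barlowStacking 1 (Real.sqrt (2 / 3)) s)
    (hinv : ∀ q ∈ barlowStacking 1 (Real.sqrt (2 / 3)) s, Ψ (q + τ) = Ψ q)
    (z : ℤ) {q : E3} (hq : q ∈ barlowStacking 1 (Real.sqrt (2 / 3)) s) :
    q + (z : ℝ) • τ ∈ barlowStacking 1 (Real.sqrt (2 / 3)) s ∧ Ψ (q + (z : ℝ) • τ) = Ψ q := by
  induction z with
  | zero => simpa using hq
  | succ n ih =>
    have e : q + (((n : ℤ) + 1 : ℤ) : ℝ) • τ = (q + ((n : ℤ) : ℝ) • τ) + τ := by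
      rw [Int.cast_add, Int.cast_one, add_smul, one_smul, add_assoc]
    rw [e]
    exact ⟨(hper _ ih.1).1, (hinv _ ih.1).trans ih.2⟩
  | pred n ih =>
    have e : q + ((-(n : ℤ) - 1 : ℤ) : ℝ) • τ = (q + ((-(n : ℤ) : ℤ) : ℝ) • τ) - τ := by
      rw [Int.cast_sub, Int.cast_one, sub_smul, one_smul, add_sub_assoc']
    rw [e]
    have h1 := hinv _ (hper _ ih.1).2
    rw [sub_add_cancel] at h1
    exact ⟨(hper _ ih.1).2, h1.symm.trans ih.2⟩

/-- The layer labels of a Hägg sequence are `1`-Lipschitz in the layer index. [folklore] -/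
theorem abs_haggLabel_sub_le {s : ℤ → ℤ} (hs : IsHaggSeq s) (k k' : ℤ) :
    |haggLabel s k - haggLabel s k'| ≤ |k - k'| := by
  have key : ∀ (m : ℤ) (n : ℕ), |haggLabel s (m + n) - haggLabel s m| ≤ n := by
    intro m n
    induction n with
    | zero => simp
    | succ n ih =>
      rw [Nat.cast_succ, ← add_assoc, haggLabel_succ]
      have h1 : |s (m + n)| = 1 := by rcases hs (m + n) with h | h <;> simp [h]
      calc |haggLabel s (m + ↑n) + s (m + ↑n) - haggLabel s m|
          = |(haggLabel s (m + ↑n) - haggLabel s m) + s (m + ↑n)| := by congr 1; ring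
        _ ≤ |haggLabel s (m + ↑n) - haggLabel s m| + |s (m + ↑n)| := abs_add_le _ _
        _ ≤ n + 1 := by rw [h1]; linarith
  rcases le_or_gt k' k with h | h
  · obtain ⟨n, rfl⟩ : ∃ n : ℕ, k = k' + n := ⟨(k - k').toNat, by omega⟩
    rw [add_sub_cancel_left, Nat.abs_cast]
    exact key k' n
  · obtain ⟨n, rfl⟩ : ∃ n : ℕ, k' = k + n := ⟨(k' - k).toNat, by omega⟩
    rw [abs_sub_comm, abs_sub_comm k, add_sub_cancel_left, Nat.abs_cast]
    exact key k n
set_option maxHeartbeats 400000 in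
/-- **Index bounds.** Two sites of the model at distance `≤ R` have layer and in-layer indices
differing by at most `3 R` (the cubic box). [folklore] -/
theorem index_bounds {s : ℤ → ℤ} (hs : IsHaggSeq s) {k i j k₀ i₀ j₀ : ℤ} {R : ℝ}
    (hd : dist (barlowPos 1 (Real.sqrt (2 / 3)) s k i j)
      (barlowPos 1 (Real.sqrt (2 / 3)) s k₀ i₀ j₀) ≤ R) :
    |(k : ℝ) - k₀| ≤ 3 * R ∧ |(i : ℝ) - i₀| ≤ 3 * R ∧ |(j : ℝ) - j₀| ≤ 3 * R := by
  have hR : 0 ≤ R := dist_nonneg.trans hd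
  have hLK : |(haggLabel s k : ℝ) - haggLabel s k₀| ≤ |(k : ℝ) - k₀| := by
    exact_mod_cast abs_haggLabel_sub_le hs k k₀
  have h3 : (√3 : ℝ) ^ 2 = 3 := Real.sq_sqrt (by norm_num)
  have h23 : (Real.sqrt (2 / 3)) ^ 2 = 2 / 3 := Real.sq_sqrt (by norm_num)
  set L : ℝ := (haggLabel s k : ℝ) with hL
  set L₀ : ℝ := (haggLabel s k₀ : ℝ) with hL₀
  have hd2 := pow_le_pow_left₀ dist_nonneg hd 2
  rw [dist_barlowPos_sq] at hd2
  have e1 : (1 * √3 / 2 * (((j : ℝ) - j₀) + (L - L₀) / 3)) ^ 2 =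
      3 / 4 * (((j : ℝ) - j₀) + (L - L₀) / 3) ^ 2 := by
    linear_combination ((((j : ℝ) - j₀) + (L - L₀) / 3) ^ 2 / 4) * h3
  have e2 : (((k : ℝ) - k₀) * Real.sqrt (2 / 3)) ^ 2 = 2 / 3 * ((k : ℝ) - k₀) ^ 2 := by
    linear_combination (((k : ℝ) - k₀) ^ 2) * h23
  rw [e1, e2, one_mul] at hd2
  have hX0sq : (((i : ℝ) - i₀) + ((j : ℝ) - j₀) / 2 + (L - L₀) / 2) ^ 2 ≤ R ^ 2 := by
    nlinarith [sq_nonneg (((j : ℝ) - j₀) + (L - L₀) / 3), sq_nonneg ((k : ℝ) - k₀)]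
  have hX1sq : (((j : ℝ) - j₀) + (L - L₀) / 3) ^ 2 ≤ (4 / 3 * R) ^ 2 := by
    nlinarith [sq_nonneg (((i : ℝ) - i₀) + ((j : ℝ) - j₀) / 2 + (L - L₀) / 2),
      sq_nonneg ((k : ℝ) - k₀), sq_nonneg R]
  have hKsq : ((k : ℝ) - k₀) ^ 2 ≤ (2 * R) ^ 2 := by
    nlinarith [sq_nonneg (((i : ℝ) - i₀) + ((j : ℝ) - j₀) / 2 + (L - L₀) / 2),
      sq_nonneg (((j : ℝ) - j₀) + (L - L₀) / 3), sq_nonneg R]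
  have hX0 := abs_le.1 (abs_le_of_sq_le_sq hX0sq hR)
  have hX1 := abs_le.1 (abs_le_of_sq_le_sq hX1sq (by linarith))
  have hK := abs_le.1 (abs_le_of_sq_le_sq hKsq (by linarith))
  have hL2 := abs_le.1 (hLK.trans (abs_le.2 hK))
  exact ⟨abs_le.2 ⟨by linarith, by linarith⟩, abs_le.2 ⟨by linarith, by linarith⟩,
    abs_le.2 ⟨by linarith, by linarith⟩⟩

/-! ## Counting sites in a box -/

/-- A set covered by the image of an integer box `[lo₁, hi₁] × [lo₂, hi₂] × [lo₃, hi₃]` has at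
most `(hi₁ + 1 - lo₁) (hi₂ + 1 - lo₂) (hi₃ + 1 - lo₃)` elements. [folklore] -/
theorem ncard_le_of_box (W : Set E3) (g : ℤ → ℤ → ℤ → E3) {lo₁ hi₁ lo₂ hi₂ lo₃ hi₃ : ℤ}
    (h₁ : lo₁ ≤ hi₁ + 1) (h₂ : lo₂ ≤ hi₂ + 1) (h₃ : lo₃ ≤ hi₃ + 1)
    (hW : ∀ y ∈ W, ∃ k i j, (lo₁ ≤ k ∧ k ≤ hi₁) ∧ (lo₂ ≤ i ∧ i ≤ hi₂) ∧ (lo₃ ≤ j ∧ j ≤ hi₃) ∧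
      y = g k i j) :
    (W.ncard : ℝ) ≤ ((hi₁ : ℝ) + 1 - lo₁) * (((hi₂ : ℝ) + 1 - lo₂) * ((hi₃ : ℝ) + 1 - lo₃)) := by
  classical
  set F : Finset (ℤ × ℤ × ℤ) :=
    Finset.Icc lo₁ hi₁ ×ˢ (Finset.Icc lo₂ hi₂ ×ˢ Finset.Icc lo₃ hi₃) with hF
  have hsub : W ⊆ (fun t : ℤ × ℤ × ℤ => g t.1 t.2.1 t.2.2) '' (F : Set (ℤ × ℤ × ℤ)) := by
    intro y hy
    obtain ⟨k, i, j, hk, hi, hj, rfl⟩ := hW y hy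
    refine ⟨(k, i, j), ?_, rfl⟩
    simp only [hF, Finset.coe_product, Finset.coe_Icc, Set.mem_prod, Set.mem_Icc]
    exact ⟨hk, hi, hj⟩
  have hfin : ((fun t : ℤ × ℤ × ℤ => g t.1 t.2.1 t.2.2) '' (F : Set (ℤ × ℤ × ℤ))).Finite :=
    F.finite_toSet.image _
  have h1 : W.ncard ≤ F.card :=
    (Set.ncard_le_ncard hsub hfin).trans
      ((Set.ncard_image_le F.finite_toSet).trans (Set.ncard_coe_finset F).le)
  have h2 : (F.card : ℤ) = (hi₁ + 1 - lo₁) * ((hi₂ + 1 - lo₂) * (hi₃ + 1 - lo₃)) := by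
    rw [hF, Finset.card_product, Finset.card_product]
    push_cast
    rw [Int.card_Icc_of_le _ _ h₁, Int.card_Icc_of_le _ _ h₂, Int.card_Icc_of_le _ _ h₃]
  have h3 : (W.ncard : ℝ) ≤ (F.card : ℝ) := by exact_mod_cast h1
  have h4 : (F.card : ℝ) =
      ((hi₁ : ℝ) + 1 - lo₁) * (((hi₂ : ℝ) + 1 - lo₂) * ((hi₃ : ℝ) + 1 - lo₃)) := by
    exact_mod_cast h2
  linarith

/-- **Quadratic box count.** A set covered by the image of a box whose first side has constant
length `D + 1` and whose two other sides have length `2 M n + 1` has at most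
`(D + 1) (2 M + 1)² (n + 1)²` elements. [folklore] -/
theorem ncard_le_quadratic (W : Set E3) (g : ℤ → ℤ → ℤ → E3) {c₁ c₂ c₃ D : ℤ} {M n : ℕ}
    (hD : 0 ≤ D)
    (hW : ∀ y ∈ W, ∃ k i j, (c₁ ≤ k ∧ k ≤ c₁ + D) ∧ (c₂ - M * n ≤ i ∧ i ≤ c₂ + M * n) ∧
      (c₃ - M * n ≤ j ∧ j ≤ c₃ + M * n) ∧ y = g k i j) :
    (W.ncard : ℝ) ≤ ((D : ℝ) + 1) * (2 * M + 1) ^ 2 * ((n : ℝ) + 1) ^ 2 := by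
  have hMn : (0 : ℤ) ≤ (M : ℤ) * n := by positivity
  have h := ncard_le_of_box W g (by linarith) (by linarith) (by linarith) hW
  have e : ((c₁ + D : ℤ) : ℝ) + 1 - c₁ = D + 1 := by push_cast; ring
  have e' : ∀ c : ℤ, ((c + M * n : ℤ) : ℝ) + 1 - ((c - M * n : ℤ) : ℝ) = 2 * M * n + 1 := by
    intro c; push_cast; ring
  rw [e, e', e'] at h
  have hD' : (0 : ℝ) ≤ D := by exact_mod_cast hD
  have h0 : (0 : ℝ) ≤ 2 * M * n + 1 := by positivity
  have h1 : 2 * (M : ℝ) * n + 1 ≤ (2 * M + 1) * (n + 1) := by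
    nlinarith [(Nat.cast_nonneg M : (0 : ℝ) ≤ M), (Nat.cast_nonneg n : (0 : ℝ) ≤ n)]
  calc (W.ncard : ℝ) ≤ _ := h
    _ ≤ ((D : ℝ) + 1) * (((2 * M + 1) * (n + 1)) * ((2 * M + 1) * (n + 1))) :=
        mul_le_mul_of_nonneg_left (mul_le_mul h1 h1 h0 (h0.trans h1)) (by linarith)
    _ = ((D : ℝ) + 1) * (2 * M + 1) ^ 2 * ((n : ℝ) + 1) ^ 2 := by ring

/-- An integer box membership from a real absolute-value bound. [folklore] -/
theorem mem_box_of_abs_le {c c₀ : ℤ} {M n : ℕ} (h : |(c : ℝ) - c₀| ≤ M * n) :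
    c₀ - M * n ≤ c ∧ c ≤ c₀ + M * n := by
  have h' : |c - c₀| ≤ (M : ℤ) * n := by exact_mod_cast h
  rw [abs_le] at h'
  constructor <;> linarith [h'.1, h'.2]

/-- The residue window: `c₀ ≤ c - ((c - c₀) / e) e ≤ c₀ + |e|` for `e ≠ 0`. [folklore] -/
theorem mem_window_ediv (c c₀ : ℤ) {e : ℤ} (he : e ≠ 0) :
    c₀ ≤ c - (c - c₀) / e * e ∧ c - (c - c₀) / e * e ≤ c₀ + |e| := by
  have h0 : c - (c - c₀) / e * e = c₀ + (c - c₀) % e := by rw [Int.emod_def]; ring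
  have h1 := Int.emod_nonneg (c - c₀) he
  have h2 := Int.emod_lt_abs (c - c₀) he
  constructor <;> linarith

/-- The quotient `(c - c₀) / e` is at most `|c - c₀|` in absolute value (real form). [folklore] -/
theorem abs_cast_ediv_le {c c₀ : ℤ} (e : ℤ) {R : ℝ} (h : |(c : ℝ) - c₀| ≤ R) :
    |(((c - c₀) / e : ℤ) : ℝ)| ≤ R := by
  have h1 : |(c - c₀) / e| ≤ |c - c₀| := Int.abs_ediv_le_abs _ _
  have h2 : |(((c - c₀) / e : ℤ) : ℝ)| ≤ |(c : ℝ) - c₀| := by exact_mod_cast h1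
  exact h2.trans h

/-! ## Reduction modulo the period -/

/-- **Reduced index bounds.** If `q` is within `n` of the base site and `|z| ≤ 3 n`, then the
indices of the reduced site `q - z • τ` differ from those of the base site by at most `M n`,
`M ≥ 3 + 9 ‖τ‖`. [folklore] -/
theorem reduced_index_bounds {s : ℤ → ℤ} (hs : IsHaggSeq s) {τ q : E3} {M n : ℕ} {z : ℤ}
    {k₀ i₀ j₀ k' i' j' : ℤ} (hM : 3 + 9 * ‖τ‖ ≤ M)
    (hqd : dist q (barlowPos 1 (Real.sqrt (2 / 3)) s k₀ i₀ j₀) ≤ n) (hz : |(z : ℝ)| ≤ 3 * n)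
    (hq' : q - (z : ℝ) • τ = barlowPos 1 (Real.sqrt (2 / 3)) s k' i' j') :
    |(k' : ℝ) - k₀| ≤ M * n ∧ |(i' : ℝ) - i₀| ≤ M * n ∧ |(j' : ℝ) - j₀| ≤ M * n := by
  have hn : (0 : ℝ) ≤ n := Nat.cast_nonneg n
  have hd : dist (barlowPos 1 (Real.sqrt (2 / 3)) s k' i' j')
      (barlowPos 1 (Real.sqrt (2 / 3)) s k₀ i₀ j₀) ≤ n + 3 * n * ‖τ‖ := by
    rw [← hq']
    calc dist (q - (z : ℝ) • τ) (barlowPos 1 (Real.sqrt (2 / 3)) s k₀ i₀ j₀)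
        ≤ dist (q - (z : ℝ) • τ) q + dist q (barlowPos 1 (Real.sqrt (2 / 3)) s k₀ i₀ j₀) :=
          dist_triangle _ _ _
      _ = |(z : ℝ)| * ‖τ‖ + dist q (barlowPos 1 (Real.sqrt (2 / 3)) s k₀ i₀ j₀) := by
          rw [dist_self_sub_left, norm_smul, Real.norm_eq_abs]
      _ ≤ 3 * n * ‖τ‖ + n :=
          add_le_add (mul_le_mul_of_nonneg_right hz (norm_nonneg τ)) hqd
      _ = n + 3 * n * ‖τ‖ := by ring
  have hb := index_bounds hs hd
  have hMn : 3 * (n + 3 * n * ‖τ‖) ≤ M * n := by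
    nlinarith [mul_nonneg (sub_nonneg.2 hM) hn, norm_nonneg τ]
  exact ⟨hb.1.trans hMn, hb.2.1.trans hMn, hb.2.2.trans hMn⟩

/-- The layer index of a reduced site `q - z • τ`, `τ = barlowPos 1 √(2/3) s m a b`. [folklore] -/
theorem layer_of_sub_zsmul {s : ℤ → ℤ} {k i j m a b z k' i' j' : ℤ}
    (h : barlowPos 1 (Real.sqrt (2 / 3)) s k i j - (z : ℝ) • barlowPos 1 (Real.sqrt (2 / 3)) s m a b
      = barlowPos 1 (Real.sqrt (2 / 3)) s k' i' j') :
    k' = k - z * m := by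
  have e2 := congrArg (fun x : E3 => x 2) h
  simp only [PiLp.sub_apply, PiLp.smul_apply, barlowPos_apply_two, smul_eq_mul] at e2
  have hh : Real.sqrt (2 / 3) ≠ 0 := (Real.sqrt_pos.2 (by norm_num)).ne'
  have e3 : ((k' : ℝ) - (k - z * m)) * Real.sqrt (2 / 3) = 0 := by linear_combination -e2
  have e4 := sub_eq_zero.1 ((mul_eq_zero.1 e3).resolve_right hh)
  have e5 : (k' : ℝ) = ((k - z * m : ℤ) : ℝ) := by push_cast; exact e4
  exact_mod_cast e5

/-- In-layer periods act on the indices: `barlowPos k i j - z • barlowPos 0 a b =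
barlowPos k (i - z a) (j - z b)`. [folklore] -/
theorem barlowPos_sub_zsmul_inLayer (h : ℝ) (s : ℤ → ℤ) (k i j a b z : ℤ) :
    barlowPos 1 h s k i j - (z : ℝ) • barlowPos 1 h s 0 a b =
      barlowPos 1 h s k (i - z * a) (j - z * b) := by
  simp only [barlowPos, haggLabel_zero, Int.cast_zero, zero_smul, add_zero, Int.cast_sub,
    Int.cast_mul]
  module

/-! ## The three cases of the reduction -/

/-- **Case `m ≠ 0`** (the period has a vertical component): reduce the layer index modulo `m`.
[folklore] -/
theorem growth_of_layer_period {S : Set E3} {s : ℤ → ℤ} {Ψ : E3 → E3} {τ : E3}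
    (hs : IsHaggSeq s)
    (hstar : ∀ p ∈ barlowStacking 1 (Real.sqrt (2 / 3)) s, bondNbrs S (Ψ p) ⊆ Ψ '' contacts s p)
    (hred : ∀ q ∈ barlowStacking 1 (Real.sqrt (2 / 3)) s, ∀ z : ℤ,
      q - (z : ℝ) • τ ∈ barlowStacking 1 (Real.sqrt (2 / 3)) s ∧ Ψ (q - (z : ℝ) • τ) = Ψ q)
    {m a b : ℤ} (hτe : τ = barlowPos 1 (Real.sqrt (2 / 3)) s m a b) (hm : m ≠ 0)
    (k₀ i₀ j₀ : ℤ) :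
    ∃ K : ℝ, ∀ n : ℕ, (Set.ncard (windowBall S
      (Ψ (barlowPos 1 (Real.sqrt (2 / 3)) s k₀ i₀ j₀)) n) : ℝ) ≤ K * ((n : ℝ) + 1) ^ 2 := by
  obtain ⟨M, hM⟩ : ∃ M : ℕ, 3 + 9 * ‖τ‖ ≤ M := ⟨_, Nat.le_ceil _⟩
  refine ⟨(((|m| : ℤ) : ℝ) + 1) * (2 * M + 1) ^ 2, fun n => ncard_le_quadratic _
    (fun k i j => Ψ (barlowPos 1 (Real.sqrt (2 / 3)) s k i j)) (c₁ := k₀) (c₂ := i₀) (c₃ := j₀)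
    (abs_nonneg m) fun y hy => ?_⟩
  obtain ⟨k, i, j, hqy, hqd⟩ := exists_lift_of_mem_windowBall hstar hy
  obtain ⟨⟨k', i', j', hq'e⟩, hq'Ψ⟩ := hred _ (barlowPos_mem k i j) ((k - k₀) / m)
  have hb := reduced_index_bounds hs hM hqd (abs_cast_ediv_le m (index_bounds hs hqd).1) hq'e
  have hk' : k' = k - (k - k₀) / m * m := layer_of_sub_zsmul (by rw [← hτe]; exact hq'e)
  refine ⟨k', i', j', ?_, mem_box_of_abs_le hb.2.1, mem_box_of_abs_le hb.2.2, ?_⟩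
  · rw [hk']
    exact mem_window_ediv k k₀ hm
  · rw [← hqy, ← hq'Ψ, hq'e]

/-- **Case `m = 0`, `a ≠ 0`** (in-layer period with a `u`-component): reduce the first in-layer
index modulo `a`. [folklore] -/
theorem growth_of_inLayer_period_fst {S : Set E3} {s : ℤ → ℤ} {Ψ : E3 → E3} {τ : E3}
    (hs : IsHaggSeq s)
    (hstar : ∀ p ∈ barlowStacking 1 (Real.sqrt (2 / 3)) s, bondNbrs S (Ψ p) ⊆ Ψ '' contacts s p)
    (hred : ∀ q ∈ barlowStacking 1 (Real.sqrt (2 / 3)) s, ∀ z : ℤ,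
      q - (z : ℝ) • τ ∈ barlowStacking 1 (Real.sqrt (2 / 3)) s ∧ Ψ (q - (z : ℝ) • τ) = Ψ q)
    {a b : ℤ} (hτe : τ = barlowPos 1 (Real.sqrt (2 / 3)) s 0 a b) (ha : a ≠ 0)
    (k₀ i₀ j₀ : ℤ) :
    ∃ K : ℝ, ∀ n : ℕ, (Set.ncard (windowBall S
      (Ψ (barlowPos 1 (Real.sqrt (2 / 3)) s k₀ i₀ j₀)) n) : ℝ) ≤ K * ((n : ℝ) + 1) ^ 2 := by
  obtain ⟨M, hM⟩ : ∃ M : ℕ, 3 + 9 * ‖τ‖ ≤ M := ⟨_, Nat.le_ceil _⟩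
  refine ⟨(((|a| : ℤ) : ℝ) + 1) * (2 * M + 1) ^ 2, fun n => ncard_le_quadratic _
    (fun i k j => Ψ (barlowPos 1 (Real.sqrt (2 / 3)) s k i j)) (c₁ := i₀) (c₂ := k₀) (c₃ := j₀)
    (abs_nonneg a) fun y hy => ?_⟩
  obtain ⟨k, i, j, hqy, hqd⟩ := exists_lift_of_mem_windowBall hstar hy
  obtain ⟨-, hq'Ψ⟩ := hred _ (barlowPos_mem k i j) ((i - i₀) / a)
  have hq'e := barlowPos_sub_zsmul_inLayer (Real.sqrt (2 / 3)) s k i j a b ((i - i₀) / a)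
  rw [← hτe] at hq'e
  have hb := reduced_index_bounds hs hM hqd (abs_cast_ediv_le a (index_bounds hs hqd).2.1) hq'e
  exact ⟨i - (i - i₀) / a * a, k, j - (i - i₀) / a * b, mem_window_ediv i i₀ ha,
    mem_box_of_abs_le hb.1, mem_box_of_abs_le hb.2.2, by rw [← hqy, ← hq'Ψ, hq'e]⟩

/-- **Case `m = 0`, `a = 0`, `b ≠ 0`** (in-layer period along `v`): reduce the second in-layer
index modulo `b`. [folklore] -/
theorem growth_of_inLayer_period_snd {S : Set E3} {s : ℤ → ℤ} {Ψ : E3 → E3} {τ : E3}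
    (hs : IsHaggSeq s)
    (hstar : ∀ p ∈ barlowStacking 1 (Real.sqrt (2 / 3)) s, bondNbrs S (Ψ p) ⊆ Ψ '' contacts s p)
    (hred : ∀ q ∈ barlowStacking 1 (Real.sqrt (2 / 3)) s, ∀ z : ℤ,
      q - (z : ℝ) • τ ∈ barlowStacking 1 (Real.sqrt (2 / 3)) s ∧ Ψ (q - (z : ℝ) • τ) = Ψ q)
    {b : ℤ} (hτe : τ = barlowPos 1 (Real.sqrt (2 / 3)) s 0 0 b) (hb0 : b ≠ 0)
    (k₀ i₀ j₀ : ℤ) :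
    ∃ K : ℝ, ∀ n : ℕ, (Set.ncard (windowBall S
      (Ψ (barlowPos 1 (Real.sqrt (2 / 3)) s k₀ i₀ j₀)) n) : ℝ) ≤ K * ((n : ℝ) + 1) ^ 2 := by
  obtain ⟨M, hM⟩ : ∃ M : ℕ, 3 + 9 * ‖τ‖ ≤ M := ⟨_, Nat.le_ceil _⟩
  refine ⟨(((|b| : ℤ) : ℝ) + 1) * (2 * M + 1) ^ 2, fun n => ncard_le_quadratic _
    (fun j k i => Ψ (barlowPos 1 (Real.sqrt (2 / 3)) s k i j)) (c₁ := j₀) (c₂ := k₀) (c₃ := i₀)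
    (abs_nonneg b) fun y hy => ?_⟩
  obtain ⟨k, i, j, hqy, hqd⟩ := exists_lift_of_mem_windowBall hstar hy
  obtain ⟨-, hq'Ψ⟩ := hred _ (barlowPos_mem k i j) ((j - j₀) / b)
  have hq'e := barlowPos_sub_zsmul_inLayer (Real.sqrt (2 / 3)) s k i j 0 b ((j - j₀) / b)
  rw [← hτe, mul_zero, sub_zero] at hq'e
  have hb := reduced_index_bounds hs hM hqd (abs_cast_ediv_le b (index_bounds hs hqd).2.2) hq'e
  exact ⟨j - (j - j₀) / b * b, k, i, mem_window_ediv j j₀ hb0,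
    mem_box_of_abs_le hb.1, mem_box_of_abs_le hb.2.1, by rw [← hqy, ← hq'Ψ, hq'e]⟩

end QuotientGrowth

open QuotientGrowth in
/-- **Quadratic growth of the quotient balls** (stub `stub_quotientGrowth` of the line
`develop-the-model-growth-descent`): if `Ψ` is star-surjective from the model
`barlowStacking 1 √(2/3) s` and invariant under a non-zero two-sided period `τ` of the model,
then the graph balls of the window graph of `S` about `Ψ p` have at most `K (n + 1)²` points.
[folklore] -/
theorem stub_quotientGrowth :
    ∀ (S : Set E3) (s : ℤ → ℤ) (Ψ : E3 → E3) (τ : E3), IsHaggSeq s →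
      (∀ p ∈ barlowStacking 1 (Real.sqrt (2 / 3)) s, bondNbrs S (Ψ p) ⊆ Ψ '' contacts s p) →
      τ ≠ 0 → (∀ q ∈ barlowStacking 1 (Real.sqrt (2 / 3)) s, q + τ ∈ barlowStacking 1 (Real.sqrt (2 / 3)) s ∧ q - τ ∈ barlowStacking 1 (Real.sqrt (2 / 3)) s) → (∀ q ∈ barlowStacking 1 (Real.sqrt (2 / 3)) s, Ψ (q + τ) = Ψ q) →
        ∀ p ∈ barlowStacking 1 (Real.sqrt (2 / 3)) s, ∃ K : ℝ, ∀ n : ℕ,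
          (Set.ncard (windowBall S (Ψ p) n) : ℝ) ≤ K * ((n : ℝ) + 1) ^ 2 := by
  intro S s Ψ τ hs hstar hτ hper hinv p hp
  obtain ⟨k₀, i₀, j₀, rfl⟩ := hp
  have h0 : (0 : E3) ∈ barlowStacking 1 (Real.sqrt (2 / 3)) s := ⟨0, 0, 0, by simp [barlowPos]⟩
  obtain ⟨m, a, b, hτe⟩ : τ ∈ barlowStacking 1 (Real.sqrt (2 / 3)) s := by
    simpa only [zero_add] using (hper 0 h0).1
  have hred : ∀ q ∈ barlowStacking 1 (Real.sqrt (2 / 3)) s, ∀ z : ℤ,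
      q - (z : ℝ) • τ ∈ barlowStacking 1 (Real.sqrt (2 / 3)) s ∧ Ψ (q - (z : ℝ) • τ) = Ψ q := by
    intro q hq z
    have h1 := period_iterate hper hinv (-z) hq
    rwa [Int.cast_neg, neg_smul, ← sub_eq_add_neg] at h1
  rcases ne_or_eq m 0 with hm | rfl
  · exact growth_of_layer_period hs hstar hred hτe hm k₀ i₀ j₀
  rcases ne_or_eq a 0 with ha | rfl
  · exact growth_of_inLayer_period_fst hs hstar hred hτe ha k₀ i₀ j₀
  rcases ne_or_eq b 0 with hb | rfl
  · exact growth_of_inLayer_period_snd hs hstar hred hτe hb k₀ i₀ j₀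
  exact absurd (hτe.trans (by simp [barlowPos])) hτ

end Summit.AtomisticToContinuum.Crystallization.Theorems.PalmUnimodularRigidityShellsToBarlowChart

end
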